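import Mathlib.MeasureTheory.Integral.Bochner.Basic
import Mathlib.MeasureTheory.Constructions.Pi
import Mathlib.MeasureTheory.Measure.Lebesgue.Basic
import Mathlib.Topology.EMetricSpace.Lipschitz
import Mathlib.Topology.MetricSpace.Bounded
import Mathlib.Data.Fin.Tuple.Basic
import HarnessLib

/-!
# Ford–Maynard's Type-I compatible functions on vectors (the class `𝔉*_η(γ)`)

Statement layer for the construction half of K. Ford, J. Maynard, *On the theory of prime
producing sieves* (arXiv:2407.14368, 2024), §§4.1, 5.4 (conventions), 6 (Definitions 6.1–6.2)
and 9 (the `ν = 0` class `𝔉*_η(γ)` of Theorem 9.1). Ford–Maynard build sequences `w_n = f(𝐯(n))`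
from real functions `f` on variable-length vectors `𝐯(n) = (log p₁/log n, …, log p_k/log n)`;
the Type-I bound (I) for `w` is the integral identity (TypeI-f) for `f`:

  for all `r ≥ 0` and `ξ₁ + ⋯ + ξ_r ≤ γ`:
  `∑_{k ≥ r+1} ∫_{ξ_{r+1} < ⋯ < ξ_k, ξ₁+⋯+ξ_k = 1} f(ξ₁,…,ξ_k) / (ξ_{r+1} ⋯ ξ_k) = 0`,      (TypeI-f)

integrals over subsets of a hyperplane `{x₁ + ⋯ + x_k = z}` being taken with respect to the
projection measure onto the first `k − 1` coordinates [§4.2, "Notational convention"].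

This file only DEFINES the objects (everything stated here is a definition or a proved API
lemma); the theorems of Ford–Maynard about them are vendored as named facts next to their uses
(`Literature/Barriers/Parity/FordMaynardPrimeSievesMinimalTypeII.lean`).

* `FordMaynard.VecFn` — real functions on variable-length vectors, `f k : (Fin k → ℝ) → ℝ`;
  `VecFn.IsSymmetric` — Definition 6.1 (the class `𝒮`).
* `FordMaynard.sliceIntegral d w G` — `∫_{u ∈ (0,∞)^d, u₁+⋯+u_d = w} G(u) du` in the projection
  measure (parametrised by the first `d − 1` coordinates, the last one being `w − u₁ − ⋯ − u_{d−1}`);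
  `sliceIntegral_one`: for `d = 1` it is the evaluation `G(w)` (`w > 0`).
* `FordMaynard.TypeIIdentity γ f` — (TypeI-f), in the UNORDERED form
  `∑_{d ≥ 1} (1/d!) ∫_{u ∈ (0,∞)^d, |u| = 1 − |ξ|} f(ξ, u)/(u₁⋯u_d) du = 0`, which for `f ∈ 𝒮` is the
  printed ordered form (the integrand is symmetric in `u`, the diagonals are null and the
  projection measure is permutation invariant; Ford–Maynard use this form themselves, §6.1
  (Tzero): "it is convenient here to leave the variables unordered, and introduce the factor
  `1/k!` to compensate"); the series over `d` is a finite sum for the functions considered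
  (support in dimension `≤ 1/η`), and is transcribed as "the partial sums vanish from some point on".
* `FordMaynard.IsConvexPolytope` — Definition 5.7; `FordMaynard.IsPiecewiseLipschitz` —
  Definition 6.2 (b) ("a finite sum of functions each supported on a convex polytope and
  Lipschitz continuous on the polytope").
* `FordMaynard.MemTypeIStar η γ f` — `f ∈ 𝔉*_η(γ)` (§9, before Theorem 9.1): `f ∈ 𝒮` bounded,
  supported on the vectors of `𝒞(ℛ*(γ))` with all components `≥ η`, satisfying Definition 6.2
  (b) and (c). Here `ℛ*(γ)` is the set of vectors with components in `(0, 1 − γ)` summing to `1`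
  and `𝒞(·)` denotes coagulations (Definition 4.5); since every vector with positive components
  summing to `1` is a coagulation of a vector of `ℛ*(γ)` (fragment each component into equal
  pieces `< 1 − γ`), for `0 < η` and `γ < 1` the support condition reads: all components `≥ η`
  and sum `= 1` — which is how it is transcribed (`MemTypeIStar.support`).

Design notes. Vectors of dimension `k` are `Fin k → ℝ` (sup norm; "Lipschitz" = `LipschitzOnWith`
for some constant, a norm-independent notion). The general class `𝔉_η(P)` of Definition 6.2
(support in `𝒞(ℛ(P))`, `P = (γ, θ, ν)`) and the region `ℛ(P)` are deliberately NOT here yet; they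
enter with Theorem 6.3.

## References

* K. Ford, J. Maynard, *On the theory of prime producing sieves*, arXiv:2407.14368v1 (2024):
  §4.1 Definitions 4.1–4.5; §4.2 (projection-measure convention); §5.3 Definition 5.7; §6
  Definitions 6.1, 6.2, (TypeI-f), §6.1 (Tzero); §9 (the class `𝔉*_η(γ)`, Theorem 9.1).
  (`lit read arxiv:2407.14368`, chunks 12, 19, 22–23, 50.) [FordMaynard2024PrimeSieves]
-/

noncomputable section

open MeasureTheory Finset

namespace Literature.NumberTheory.Sieve.FordMaynard

/-! ### Functions on variable-length vectors -/

/-- Real-valued functions on variable-length real vectors: `f k` is the restriction to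
dimension `k` (vectors `Fin k → ℝ`; the empty vector is the unique element of `Fin 0 → ℝ`).
[cite: FordMaynard2024PrimeSieves, Definition 6.1] -/
abbrev VecFn : Type := (k : ℕ) → (Fin k → ℝ) → ℝ

/-- Ford–Maynard's class `𝒮` (Definition 6.1): for every `k` the restriction of `f` to `ℝ^k` is
symmetric in all variables. [cite: FordMaynard2024PrimeSieves, Definition 6.1] -/
def VecFn.IsSymmetric (f : VecFn) : Prop :=
  ∀ (k : ℕ) (σ : Equiv.Perm (Fin k)) (ξ : Fin k → ℝ), f k (ξ ∘ σ) = f k ξ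

/-- `f ∈ 𝒮` is unchanged by precomposing with any permutation (restatement). [cite: FordMaynard2024PrimeSieves, Definition 6.1] -/
theorem VecFn.IsSymmetric.comp_perm {f : VecFn} (hf : f.IsSymmetric) {k : ℕ}
    (σ : Equiv.Perm (Fin k)) (ξ : Fin k → ℝ) : f k (ξ ∘ σ) = f k ξ :=
  hf k σ ξ

/-! ### Integrals over slices of the positive orthant -/

/-- The slice integral `∫_{u ∈ (0,∞)^d, u₁ + ⋯ + u_d = w} G(u) du` with respect to the projection
measure onto the first `d − 1` coordinates [§4.2, Notational convention]: for `d = d' + 1` it is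
the Lebesgue integral over `u' ∈ ℝ^{d'}` with `u'_i > 0`, `∑ u'_i < w`, of `G(u', w − ∑ u'_i)`;
for `d = 0` (no variable; never used by the source) it is `0`.
[cite: FordMaynard2024PrimeSieves, §4.2 (Notational convention)] -/
def sliceIntegral : (d : ℕ) → ℝ → ((Fin d → ℝ) → ℝ) → ℝ
  | 0, _, _ => 0
  | d + 1, w, G => ∫ u : Fin d → ℝ,
      (if (∀ i, 0 < u i) ∧ ∑ i, u i < w then G (Fin.snoc u (w - ∑ i, u i)) else 0)

/-- In dimension `1` the slice `{u₁ = w}` is a point and the slice integral is the evaluation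
`G(w)` (for `w > 0`; `0` otherwise) — the `k = r + 1` terms of (TypeI-f).
[cite: FordMaynard2024PrimeSieves, §4.2 (Notational convention)] -/
theorem sliceIntegral_one (w : ℝ) (G : (Fin 1 → ℝ) → ℝ) :
    sliceIntegral 1 w G = if 0 < w then G (fun _ => w) else 0 := by
  simp only [sliceIntegral]
  rw [Measure.volume_pi_eq_dirac (fun _ => (0 : ℝ)), integral_dirac]
  simp only [IsEmpty.forall_iff, true_and, Finset.univ_eq_empty, Finset.sum_empty, sub_zero]
  rfl

/-- The slice integral of the zero function vanishes. [folklore] -/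
theorem sliceIntegral_zero (d : ℕ) (w : ℝ) : sliceIntegral d w (fun _ => 0) = 0 := by
  cases d with
  | zero => rfl
  | succ d => simp [sliceIntegral]

/-! ### The Type-I identity (TypeI-f) -/

/-- The `d`-th term of (TypeI-f) at the fixed components `ξ ∈ ℝ^r` (unordered form):
`(1/d!) ∫_{u ∈ (0,∞)^d, |u| = 1 − |ξ|} f(ξ, u) / (u₁ ⋯ u_d) du`, the concatenation `(ξ, u)`
being `Fin.append ξ u ∈ ℝ^{r+d}`. [cite: FordMaynard2024PrimeSieves, Definition 6.2 (c)] -/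
def typeITerm (f : VecFn) (r : ℕ) (ξ : Fin r → ℝ) (d : ℕ) : ℝ :=
  (1 / (d.factorial : ℝ)) *
    sliceIntegral d (1 - ∑ i, ξ i) (fun u => f (r + d) (Fin.append ξ u) / ∏ i, u i)

/-- **(TypeI-f)** (Definition 6.2 (c)) for the level parameter `γ`: for all `r ≥ 0` and all
`ξ ∈ ℝ^r` with `ξ₁ + ⋯ + ξ_r ≤ γ`,
`∑_{k ≥ r+1} ∫_{ξ_{r+1} < ⋯ < ξ_k, ξ₁+⋯+ξ_k = 1} f(ξ₁, …, ξ_k)/(ξ_{r+1} ⋯ ξ_k) = 0`, written with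
the unordered terms `typeITerm f r ξ d`, `d = k − r ≥ 1`, over the positive orthant
`ξ_{r+1}, …, ξ_k > 0` (equal to the printed ordered integrals for `f ∈ 𝒮` supported on vectors
with positive components, see the module docstring), the series being transcribed as: its
partial sums vanish from some point on (for `f` supported in dimensions `≤ 1/η` all terms with
`r + d > 1/η` are zero, so this is the printed finite identity). [cite: FordMaynard2024PrimeSieves, Definition 6.2 (c)] -/
def TypeIIdentity (γ : ℝ) (f : VecFn) : Prop :=
  ∀ (r : ℕ) (ξ : Fin r → ℝ), ∑ i, ξ i ≤ γ →
    ∃ N₀ : ℕ, ∀ N : ℕ, N₀ ≤ N → ∑ d ∈ Finset.Icc 1 N, typeITerm f r ξ d = 0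

/-! ### Convex polytopes and piecewise Lipschitz functions -/

/-- A **convex polytope** in `ℝ^k` (Definition 5.7): a bounded set cut out by finitely many
linear constraints `c · x < b` (the family `S`) or `c · x ≤ b` (the family `T`). For `k = 0`
the only such set containing the empty vector is `{∅}` ("the trivial polytope").
[cite: FordMaynard2024PrimeSieves, Definition 5.7] -/
def IsConvexPolytope {k : ℕ} (P : Set (Fin k → ℝ)) : Prop :=
  Bornology.IsBounded P ∧
    ∃ S T : Finset ((Fin k → ℝ) × ℝ),
      P = {x | (∀ c ∈ S, ∑ i, c.1 i * x i < c.2) ∧ ∀ c ∈ T, ∑ i, c.1 i * x i ≤ c.2}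

/-- Definition 6.2 (b) for one dimension `k`: `g : ℝ^k → ℝ` is a finite sum of functions `h_j`,
each supported on a convex polytope `P_j` and Lipschitz continuous on `P_j`.
[cite: FordMaynard2024PrimeSieves, Definition 6.2 (b)] -/
def IsPiecewiseLipschitz {k : ℕ} (g : (Fin k → ℝ) → ℝ) : Prop :=
  ∃ (m : ℕ) (P : Fin m → Set (Fin k → ℝ)) (h : Fin m → (Fin k → ℝ) → ℝ),
    (∀ j, IsConvexPolytope (P j) ∧ (∀ x, x ∉ P j → h j x = 0) ∧
      ∃ K, LipschitzOnWith K (h j) (P j)) ∧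
    ∀ x, g x = ∑ j, h j x

/-! ### The class `𝔉*_η(γ)` -/

/-- **`f ∈ 𝔉*_η(γ)`** (Ford–Maynard §9, the "`ν = 0`" analogue of Definition 6.2 used in
Theorem 9.1): `f ∈ 𝒮` (symmetric in all variables for each dimension) is bounded and supported
on the vectors of `𝒞(ℛ*(γ))` all of whose components are `≥ η` — for `0 < η`, `γ < 1` exactly
the vectors with all components `≥ η` and sum `1` (module docstring) —, each restriction
`f k` is piecewise Lipschitz on convex polytopes (Definition 6.2 (b)), and `f` satisfies the
Type-I identity (TypeI-f) with parameter `γ` (Definition 6.2 (c)). Consequently `f k = 0` for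
`k > 1/η` (`MemTypeIStar.eq_zero_of_lt`). [cite: FordMaynard2024PrimeSieves, §9 (definition of 𝔉*_η(γ) before Theorem 9.1) and Definition 6.2] -/
structure MemTypeIStar (η γ : ℝ) (f : VecFn) : Prop where
  symm : f.IsSymmetric
  support : ∀ (k : ℕ) (ξ : Fin k → ℝ), f k ξ ≠ 0 → (∀ i, η ≤ ξ i) ∧ ∑ i, ξ i = 1
  bounded : ∃ F : ℝ, ∀ (k : ℕ) (ξ : Fin k → ℝ), |f k ξ| ≤ F
  piecewiseLipschitz : ∀ k : ℕ, IsPiecewiseLipschitz (f k)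
  typeI : TypeIIdentity γ f

namespace MemTypeIStar

variable {η γ : ℝ} {f : VecFn}

/-- A function of `𝔉*_η(γ)` (`η > 0`) vanishes in every dimension `k > 1/η`: a vector in its
support has `k` components `≥ η` summing to `1`, so `k η ≤ 1`.
[cite: FordMaynard2024PrimeSieves, §6 (remark after Definition 6.2)] -/
theorem eq_zero_of_lt (hf : MemTypeIStar η γ f) (hη : 0 < η) {k : ℕ} (hk : 1 / η < k)
    (ξ : Fin k → ℝ) : f k ξ = 0 := by
  by_contra h
  obtain ⟨hge, hsum⟩ := hf.support k ξ h
  have hle : (k : ℝ) * η ≤ ∑ i, ξ i := by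
    calc (k : ℝ) * η = ∑ _i : Fin k, η := by simp
      _ ≤ ∑ i, ξ i := Finset.sum_le_sum fun i _ => hge i
  rw [hsum] at hle
  have : (k : ℝ) ≤ 1 / η := by rwa [le_div_iff₀ hη]
  linarith

/-- A function of `𝔉*_η(γ)` (`η > 0`) vanishes on the empty vector (its components sum to
`0 ≠ 1`). [cite: FordMaynard2024PrimeSieves, Definition 6.2 (a)] -/
theorem apply_zero (hf : MemTypeIStar η γ f) (ξ : Fin 0 → ℝ) : f 0 ξ = 0 := by
  by_contra h
  have := (hf.support 0 ξ h).2
  simp at this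

/-- The components of a vector in the support of `f ∈ 𝔉*_η(γ)` are positive when `η > 0`.
[cite: FordMaynard2024PrimeSieves, Definition 6.2 (a)] -/
theorem pos_of_ne_zero (hf : MemTypeIStar η γ f) (hη : 0 < η) {k : ℕ} {ξ : Fin k → ℝ}
    (h : f k ξ ≠ 0) (i : Fin k) : 0 < ξ i :=
  lt_of_lt_of_le hη ((hf.support k ξ h).1 i)

end MemTypeIStar

end Literature.NumberTheory.Sieve.FordMaynard
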